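import Summits.ABC.IUTFork.Repair.RHInSigmaDatum
import Summits.ABC.IUTFork.Repair.RHDiffPricedDoor
import Summits.ABC.IUTFork.Repair.RHReachLedgerQ2
import HarnessLib

/-!
# R-H ROUND 2, Q1 second hand — the two remaining DATUM-strata rows 16 «diffpriced» and 27 «reach-ledger»:
# the datum-class predicates `InSigma16 (D)` / `InSigma27 (D)` over `Cor312Prov.pilotDataOfK`, row 16 ⊆ row 15 at the datum level, and the doors BY NAME

abc-iut cell, rung LADDER-ABC:A2.RESCUE.H; seat abc-iut-rh2-xi-2 gen 2 (successor of gen 0's `Repair/RHInSigmaDatum.lean`, p470383: rows 8 / 15 / 18).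
abc-iut-rh-lead `plan/rescue/R-H/ROUND2/START-HERE.md` v1.3 §2 «rh2-xi-2: Q1 second hand for DATUM-strata rows 8/15/18/16/27: confirm Q1
MOOT-ON-DATUM-Σ by NAME and type the one-line datum-class predicate `InSigma_row (D) : Prop` per row over pilotDataOfK — hand to rh2-q2-hull»;
abc-iut-rh2-ref-2 22:22:25Z scope note (ii) «rows 16/27 Q1 words still owed by xi-2 (row 16 door p464040 exists; row 27 doorless)». Reading note of
record: `HOME/abc-iut-rh2-xi-2/XI-EF-READING-16-27.md` (print side = gen 0's `XI-EF-READING-8-15-18.md` §A, 22/22 loci confirmed by abc-iut-rp-lit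
21:33:34Z — steps (xi-e)/(xi-f) of [IUTchIII] Cor. 3.12 act on the two totals only, so the per-row question is the Σ-membership predicate and its
door). TAKES NO SIDE on [IUTchIII] Cor. 3.12 or on any author; every `InSigma…` below is a claim-tagged HYPOTHESIS SHAPE (a reading predicate on OUR
typed data), never asserted, never a Literature fact; typed ≠ proved; instantiated ≠ endorsed; nothing here asserts abc proved or refuted.
Everything is consumed BY NAME: abc-iut-lens-transfer-3 / abc-iut-rp-s2 `Repair.RH.DiffPriced.HStarDiffPriced` (p458364, row 16's H⋆), abc-iut-rh-typ-5
`Repair.RH.DiffPricedVsSlotReach.slotReachWindowK_of_hStarDiffPriced(_of_strictMinPow)` (p464040, row 16 ⟹ row 15) and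
`Repair.RH.DiffPricedDoor.exists_qPinned_and_hull_settingPrVolSharp_pilotDataOfK_of_hStarDiffPriced` (the end-to-end door over abc-iut-rp-d3's
p462301), abc-iut-rh-typ-8 `Repair.RHHeightClass.StrictMinPow` / `strictMinPow_le_one` (the UNTIED outer exponent), abc-iut-lens-wuc-1 / rh-typ-12
`Repair.RHSlotReach.SlotReachWindow(K)` (row 15's datum predicate — CITED), abc-iut-lens-nearmiss-1 `Repair.RH.ReachLedger.LedgerCell` /
`HStarReachLedgerK` (p464022, row 27's H⋆) and abc-iut-rh-typ-10 `Repair.RH.ReachLedgerQ2.LedgerAtDatum` / `HStar27OnSigma27` / `K2Target27` (p468994).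

WHAT IS TYPED.
* §1 (row 16, the genuine `K`-level datum `pilotDataOfK D K`, per-prime columns `e_p ≥ 1`, `B_p`): **`InSigma16 D eK BK`** := abc-iut-lens-transfer-3's
  `HStarDiffPriced D` AND, at every prime `p` under a bad place, the signed stratum conditions of ROUND1.tsv row 16 («p ∤ e_w, untied») read on the
  WHOLE fibre over `p`: every place `x ∣ p` of `K` has `e(x ∣ p) = e_p`, `p ∤ e_p` (TAME DIFFERENT), and `B_p` is the untied sharp outer exponent
  (`StrictMinPow p e_p B_p`, hence `B_p ≤ 1`). Then: `inSigma16_iff` (`Iff.rfl`); **`slotReachWindowK_of_inSigma16`** = ROW 16 ⊆ ROW 15 AT THE DATUM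
  LEVEL (`InSigma16 ⟹ SlotReachWindowK` at the dictionary `e ≡ e_p`, `n₀ ≡ 1`, `λ ≡ −B_p/e_p`, `mΘ = j²·m_q`; p464040 BY NAME);
  `slotReachWindow_congr_of_bad` (a clause-by-clause congruence: two dictionaries that agree on every fibre carrying a bad place give the same window)
  and **`slotReachWindowK_ramificationIdx_of_inSigma16`** (the same window at the INTRINSIC index `e(x) = e(x ∣ p)`, the currency of abc-iut-rh2-q2-hull's
  chosen-ideles door `RH2SigmaHull.pilotKummerCompatHull_chosen_of_slotReachWindowK`); **`exists_qPinned_and_hull_pilotDataOfK_of_inSigma16`** = Q1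
  MOOT-ON-DATUM-Σ(16) in kernel: the door of record (RHDiffPricedDoor §1) at ANY realising ideles, residual hypotheses = the honest idele profile and
  the two per-place certificates, exactly as gen 0's `exists_qPinned_and_hull_pilotDataOfK_of_inSigma8`.
* §2 (row 27): **`InSigma27 D`** := the per-place LEDGER `LedgerCell l⋆ p e(w ∣ p) P_w` at every bad place `w` of `pilotDataOfK D K` with the dictionary
  of record (`e_w = e(w ∣ p)`, `m_q(w) = P_w ∈ ℕ` the q-pilot degree) — the `D`-level form of abc-iut-rh-typ-10's `LedgerAtDatum T`
  (`ledgerAtDatum_iff_inSigma27 : LedgerAtDatum T ↔ InSigma27 T.D`, `Iff.rfl`), `= HStarReachLedgerK D e mq` at that dictionary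
  (`inSigma27_iff_hStarReachLedgerK`); `hStar27OnSigma27_iff_forall_inSigma27` («S|Σ₂₇» = «every admissible Szpiro-bad window datum is `InSigma27`»,
  the `InSig` grammar of abc-iut-rh2-q2-hull's generic cut `RH2SigmaHull.abc_of_inSigma_v10K_window_szpiroBadBoth` with `InSig P l T := InSigma27 T.D`).
  Row 27 is DOORLESS (ROUND1.tsv: budget class, Statement-sufficient via the new lemma L1, NOT S_H-sufficient): its door is the TARGET
  `ReachLedgerQ2.K2Target27` (arrow 1, not proved; (α)/(β) of abc-iut-rh2-L1 / rh-typ-10), so no `∃ ρ qK, QPinned ∧ PilotKummerCompatHull` corollary is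
  typed for it — `cor312OnSigma27_of_k2Target27_of_forall_inSigma27` only re-reads rh-typ-10's `cor312OnSigma27_of_k2Target27` in the `InSigma27` grammar.
HONEST SCOPE. Pure definitions-by-specialisation and compositions; no cell is decided here; whether any genuine datum lies in Σ₁₆ / Σ₂₇ inside the
typed `l`-window is round-2 Q3 (abc-iut-rh2-q3-num), NOT claimed; the size of the off-Σ deficit for data outside Σ₁₆ / Σ₂₇ is Q1/Q3 numerics in the
currency of record (abc-iut-rh-typ-12 `RHSlotReach.OffWindowDeficitLe`, abc-iut-rh2-q2-eq `RH.SigmaLicence.offRemainder`).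
[cite: Mochizuki2012, IUTchIII Cor. 3.12 p. 173–174, Step (xi-f) p. 184 l. 19–29, Prop. 3.9 (i) p. 116 l. 22–27, (iii) p. 117 l. 25–30; Rmk. 3.9.3 p. 119–120]
[cite: Mochizuki2012, IUTchI Ex. 3.2 (iv) p. 71; IUTchIV Prop. 1.1 p. 9, Prop. 1.2 (i)(ii) p. 10] [cite: SerreLocalFields1979, Ch. III §6 Prop. 13]
[cite: DupuyHilado2025, §3.3, §3.9, §4.9] [claim: Mochizuki2012, status: disputed] for every IUT locution. Standard axioms only.
-/

noncomputable section

open Set Function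
open scoped Pointwise

namespace Summit.ABC.IUTFork.Repair.RH.InSigmaDatum

open NumberField IsDedekindDomain Literature.IUT.LogThetaLattice Literature.IUT.LogVolume Literature.IUT.HodgeTheaters
  Literature.IUT.LogVolume.ThetaData Literature.NumberTheory.NumberFields
  Summit.ABC.IUTFork.Thm311 Summit.ABC.IUTFork.Thm311.Real Summit.ABC.IUTFork.Cor312 Summit.ABC.IUTFork.Cor312.Setting
  Summit.ABC.IUTFork.Cor312Vol Summit.ABC.IUTFork.Cor312Prov Summit.ABC.IUTFork.Repair.RH

/-! ## §0. A dictionary congruence for row 15's window (any fibres): only the fibres carrying a bad place matter -/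

/-- **Two dictionaries that agree on every fibre carrying a bad place give the same slot-reach window.** The `(w, i)`-clause of
abc-iut-lens-wuc-1's `RHSlotReach.SlotReachWindow` at a bad place `w ∣ p` reads the indices `e`, conductors `n₀` and radii `λ` only at places over
the SAME prime `p` (the bad place and its donor tuple); over a prime with no bad place no clause is demanded. [folklore] -/
theorem slotReachWindow_congr_of_bad {lstar : ℕ} {Fib : Nat.Primes → Type} {bad : ∀ pp, Fib pp → Prop}
    {e₁ e₂ n₁ n₂ : ∀ pp, Fib pp → ℕ} {lam₁ lam₂ : ∀ pp, Fib pp → ℝ}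
    {mΘ : ∀ pp, Fin lstar → Fib pp → ℤ} {mq : ∀ pp, Fib pp → ℤ}
    (he : ∀ (pp : Nat.Primes) (x : Fib pp), (∃ w : Fib pp, bad pp w) → e₁ pp x = e₂ pp x)
    (hn : ∀ (pp : Nat.Primes) (x : Fib pp), (∃ w : Fib pp, bad pp w) → n₁ pp x = n₂ pp x)
    (hlam : ∀ (pp : Nat.Primes) (x : Fib pp), (∃ w : Fib pp, bad pp w) → lam₁ pp x = lam₂ pp x) :
    RHSlotReach.SlotReachWindow lstar Fib bad e₁ n₁ lam₁ mΘ mq ↔ RHSlotReach.SlotReachWindow lstar Fib bad e₂ n₂ lam₂ mΘ mq := by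
  refine forall_congr' fun pp => forall_congr' fun i => forall_congr' fun w => forall_congr' fun hw =>
    forall_congr' fun x => ?_
  rw [he pp w ⟨w, hw⟩, hn pp w ⟨w, hw⟩, hlam pp w ⟨w, hw⟩]
  have hs : (∑ a, (lam₁ pp (x a) + ((-((-(n₁ pp (x a) : ℤ)) / (e₁ pp (x a) : ℤ)) : ℤ) : ℝ))) =
      ∑ a, (lam₂ pp (x a) + ((-((-(n₂ pp (x a) : ℤ)) / (e₂ pp (x a) : ℤ)) : ℤ) : ℝ)) :=
    Finset.sum_congr rfl fun a _ => by rw [he pp (x a) ⟨w, hw⟩, hn pp (x a) ⟨w, hw⟩, hlam pp (x a) ⟨w, hw⟩]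
  rw [hs]

/-! ## §1. Row 16 «diffpriced»: `InSigma16 (D)`, row 16 ⊆ row 15 at the datum level, and the door at `pilotDataOfK D K` -/

section Row16

variable {F K Fbar : Type} [Field F] [NumberField F] [Field K] [NumberField K] [Algebra F K] [Field Fbar]
  [Algebra F Fbar] [Algebra K Fbar] {E : WeierstrassCurve F} [E.IsElliptic] {l : ℕ} {Pb : BadPlacePredicates K}
  (D : InitialThetaData F K Fbar E l Pb)

/-- **`InSigma16 D eK BK` — the datum `D`, with per-prime columns `e_p ≥ 1` (ramification) and `B_p` (outer exponent), lies in the stratum Σ₁₆ of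
ROUND-1 row 16 «diffpriced»** (signed KEEP-on-slice «HEX: k ≤ 2 on p ∤ e_w, untied types», door p464040 ∘ p462301): abc-iut-lens-transfer-3's
different-priced packet cell `HStarDiffPriced D` («`(j²−1)·P_w ≤ j·(e_w·d_w)`» at every bad place `w` and label `j ∈ 𝔽_l^⋇`) AND, at every prime `p`
under a bad place of `K`, read on the whole fibre over `p`: every place `x ∣ p` has `e(x ∣ p) = e_p` with `p ∤ e_p` (TAME DIFFERENT — the stratum
where row 16 rides row 15; the wild half is the candidate's open content, `DiffPricedVsSlotReach.wild_witness`), and `B_p` is the UNTIED sharp outer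
exponent (`RHHeightClass.StrictMinPow p e_p B_p`: column `r_out♯` without tie, so `B_p ≤ 1`). One-line specialisation; NOT asserted at any datum.
[R-H datum class, hypothesis — not a fact] [cite: Mochizuki2012, IUTchI Ex. 3.2 (iv) p. 71; IUTchIV Prop. 1.1 p. 9]
[claim: Mochizuki2012, status: disputed] -/
@[claim "Mochizuki2012" "disputed"]
def InSigma16 (eK : Nat.Primes → ℕ) (BK : Nat.Primes → ℤ) : Prop :=
  DiffPriced.HStarDiffPriced D ∧ (∀ pp : Nat.Primes, 1 ≤ eK pp) ∧
    ∀ (pp : Nat.Primes) (x : (thetaIndex (pilotDataOfK D K)).Fibre (.inr pp)),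
      haveI : Fact (pp : ℕ).Prime := ⟨pp.2⟩
      (∃ w : (thetaIndex (pilotDataOfK D K)).Fibre (.inr pp), placeOf (pilotDataOfK D K) pp.1 w ∈ (pilotDataOfK D K).S) →
        (placeOf (pilotDataOfK D K) pp.1 x).asIdeal.ramificationIdx ℤ = eK pp ∧ ¬ (pp : ℕ) ∣ eK pp ∧
          RHHeightClass.StrictMinPow (pp : ℕ) (eK pp) (BK pp)

/-- `InSigma16 D eK BK` unfolds to «`HStarDiffPriced D` ∧ `e_p ≥ 1` ∧ (fibres over bad primes: `e(x ∣ p) = e_p`, `p ∤ e_p`, `StrictMinPow p e_p B_p`)».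
[folklore] -/
theorem inSigma16_iff (eK : Nat.Primes → ℕ) (BK : Nat.Primes → ℤ) :
    InSigma16 D eK BK ↔
      DiffPriced.HStarDiffPriced D ∧ (∀ pp : Nat.Primes, 1 ≤ eK pp) ∧
        ∀ (pp : Nat.Primes) (x : (thetaIndex (pilotDataOfK D K)).Fibre (.inr pp)),
          haveI : Fact (pp : ℕ).Prime := ⟨pp.2⟩
          (∃ w : (thetaIndex (pilotDataOfK D K)).Fibre (.inr pp), placeOf (pilotDataOfK D K) pp.1 w ∈ (pilotDataOfK D K).S) →
            (placeOf (pilotDataOfK D K) pp.1 x).asIdeal.ramificationIdx ℤ = eK pp ∧ ¬ (pp : ℕ) ∣ eK pp ∧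
              RHHeightClass.StrictMinPow (pp : ℕ) (eK pp) (BK pp) :=
  Iff.rfl

/-- A datum in Σ₁₆ satisfies row 16's H⋆ `HStarDiffPriced D`. [folklore] -/
theorem hStarDiffPriced_of_inSigma16 {eK : Nat.Primes → ℕ} {BK : Nat.Primes → ℤ} (h : InSigma16 D eK BK) :
    DiffPriced.HStarDiffPriced D :=
  h.1

/-- In Σ₁₆ the outer exponent under every bad place is `≤ 1` (abc-iut-rh-typ-8's `strictMinPow_le_one`). [folklore] -/
theorem outer_le_one_of_inSigma16 {eK : Nat.Primes → ℕ} {BK : Nat.Primes → ℤ} (h : InSigma16 D eK BK) :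
    ∀ (pp : Nat.Primes) (w : (thetaIndex (pilotDataOfK D K)).Fibre (.inr pp)), haveI : Fact (pp : ℕ).Prime := ⟨pp.2⟩
      placeOf (pilotDataOfK D K) pp.1 w ∈ (pilotDataOfK D K).S → BK pp ≤ 1 :=
  fun pp w hw => RHHeightClass.strictMinPow_le_one (h.2.2 pp w ⟨w, hw⟩).2.2

/-- **ROW 16 ⊆ ROW 15 AT THE DATUM LEVEL, in kernel.** A datum in Σ₁₆ satisfies abc-iut-lens-wuc-1's row-15 window `SlotReachWindowK D` at the
dictionary `e ≡ e_p`, `n₀ ≡ 1`, `λ ≡ −B_p/e_p`, `mΘ = j²·m_q`, for any integer Kummer orders `m_q(w) = P_w` at the bad places — abc-iut-rh-typ-5's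
`DiffPricedVsSlotReach.slotReachWindowK_of_hStarDiffPriced_of_strictMinPow` (p464040), BY NAME. [cite: Mochizuki2012, IUTchI Ex. 3.2 (iv) p. 71;
IUTchIV Prop. 1.1 p. 9] [cite: SerreLocalFields1979, Ch. III §6 Prop. 13] [claim: Mochizuki2012, status: disputed] -/
theorem slotReachWindowK_of_inSigma16 {eK : Nat.Primes → ℕ} {BK : Nat.Primes → ℤ}
    (mq : ∀ pp : Nat.Primes, (thetaIndex (pilotDataOfK D K)).Fibre (.inr pp) → ℤ)
    (hmq : ∀ (pp : Nat.Primes) (w : (thetaIndex (pilotDataOfK D K)).Fibre (.inr pp)), haveI : Fact (pp : ℕ).Prime := ⟨pp.2⟩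
      placeOf (pilotDataOfK D K) pp.1 w ∈ (pilotDataOfK D K).S →
        (mq pp w : ℝ) = (pilotDataOfK D K).qPilot (placeOf (pilotDataOfK D K) pp.1 w))
    (h : InSigma16 D eK BK) :
    RHSlotReach.SlotReachWindowK D (fun pp _ => eK pp) (fun _ _ => 1)
      (fun pp _ => -((BK pp : ℤ) : ℝ) / ((eK pp : ℕ) : ℝ))
      (fun pp i w => ((((i : ℕ) : ℤ) + 1) ^ 2) * mq pp w) mq :=
  DiffPricedVsSlotReach.slotReachWindowK_of_hStarDiffPriced_of_strictMinPow D eK BK h.2.1 _ _ _ _ mq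
    (fun _ _ => rfl) (fun _ _ => rfl) (fun _ _ => rfl) (fun _ _ _ => rfl)
    (fun pp w hw => (h.2.2 pp w ⟨w, hw⟩).1) (fun pp w hw => (h.2.2 pp w ⟨w, hw⟩).2.1) hmq
    (fun pp w hw => (h.2.2 pp w ⟨w, hw⟩).2.2) h.1

/-- **… at the INTRINSIC index `e(x) = e(x ∣ p)`** (the currency of abc-iut-rh2-q2-hull's `RH2SigmaHull.pilotKummerCompatHull_chosen_of_slotReachWindowK`,
via `ramIdx_eq : ramIdx K x = e(x ∣ p)`): Σ₁₆ reads the fibre over every bad prime uniformly, so the uniform and the intrinsic dictionaries agree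
wherever a clause is demanded (`slotReachWindow_congr_of_bad`). [claim: Mochizuki2012, status: disputed] -/
theorem slotReachWindowK_ramificationIdx_of_inSigma16 {eK : Nat.Primes → ℕ} {BK : Nat.Primes → ℤ}
    (mq : ∀ pp : Nat.Primes, (thetaIndex (pilotDataOfK D K)).Fibre (.inr pp) → ℤ)
    (hmq : ∀ (pp : Nat.Primes) (w : (thetaIndex (pilotDataOfK D K)).Fibre (.inr pp)), haveI : Fact (pp : ℕ).Prime := ⟨pp.2⟩
      placeOf (pilotDataOfK D K) pp.1 w ∈ (pilotDataOfK D K).S →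
        (mq pp w : ℝ) = (pilotDataOfK D K).qPilot (placeOf (pilotDataOfK D K) pp.1 w))
    (h : InSigma16 D eK BK) :
    RHSlotReach.SlotReachWindowK D
      (fun pp x => haveI : Fact (pp : ℕ).Prime := ⟨pp.2⟩; (placeOf (pilotDataOfK D K) pp.1 x).asIdeal.ramificationIdx ℤ)
      (fun _ _ => 1) (fun pp _ => -((BK pp : ℤ) : ℝ) / ((eK pp : ℕ) : ℝ))
      (fun pp i w => ((((i : ℕ) : ℤ) + 1) ^ 2) * mq pp w) mq :=
  (RHSlotReach.slotReachWindowK_iff D _ _ _ _ _).2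
    ((slotReachWindow_congr_of_bad (fun pp x hx => ((h.2.2 pp x hx).1).symm) (fun _ _ _ => rfl) (fun _ _ _ => rfl)).1
      ((RHSlotReach.slotReachWindowK_iff D _ _ _ _ _).1 (slotReachWindowK_of_inSigma16 D mq hmq h)))

variable (M : Type) [Field M] [NumberField M] {logv : PadicLogs K} (hlog : LogvAnalytic logv)
  (archPk : ∀ (j : (thetaIndex (pilotDataOfK D K)).Label) (vQ : (thetaIndex (pilotDataOfK D K)).VQ),
    Set ((logShellsDH (pilotDataOfK D K) logv).Packet j vQ))
  (archSub : ∀ (j : (thetaIndex (pilotDataOfK D K)).Label) (v : (thetaIndex (pilotDataOfK D K)).V),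
    Set ((logShellsDH (pilotDataOfK D K) logv).Packet j ((thetaIndex (pilotDataOfK D K)).over v)))
  (Ψ : ℤ → ∀ v : (thetaIndex (pilotDataOfK D K)).V, v ∈ (thetaIndex (pilotDataOfK D K)).Vbad →
    Set ((logShellsDH (pilotDataOfK D K) logv).StarPacket v))
  (act : ℤ → ∀ v : (thetaIndex (pilotDataOfK D K)).V, v ∈ (thetaIndex (pilotDataOfK D K)).Vbad →
    (logShellsDH (pilotDataOfK D K) logv).StarPacket v → Module.End ℚ ((logShellsDH (pilotDataOfK D K) logv).StarPacket v))
  (Mmod : ℤ → ∀ j : (thetaIndex (pilotDataOfK D K)).LabelStar, Set ((logShellsDH (pilotDataOfK D K) logv).GlobalPacket j.1))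
  (region : ℤ → ∀ j : (thetaIndex (pilotDataOfK D K)).LabelStar, FinDivisor M → ∀ vQ : (thetaIndex (pilotDataOfK D K)).VQ,
    Set ((logShellsDH (pilotDataOfK D K) logv).Packet j.1 vQ))
  (n : ℤ) {HT : Type} {LogLink : HT → HT → Type} {IsFull : ∀ {s t : HT}, LogLink s t → Prop}
  (lat : LGPGaussianLogThetaLattice LogLink IsFull)
  {Frd : Type} {IsoF : Frd → Frd → Type} {Ob : Frd → Type} {realify : Frd → Frd} {Strip : Type}
  {IsoS : Strip → Strip → Type}
  {Mv : ∀ v : (thetaIndex (pilotDataOfK D K)).V, v ∈ (thetaIndex (pilotDataOfK D K)).Vbad → Type} [∀ v h, Monoid (Mv v h)]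
  (sig : GlobalLGPFrobenioidSignature (thetaIndex (pilotDataOfK D K)).lstar (thetaIndex (pilotDataOfK D K)).V
    (· ∈ (thetaIndex (pilotDataOfK D K)).Vbad) Frd IsoF Ob realify Strip IsoS Mv)
  (split : SplittingMonoids Mv) {ObΔ : Type}
  {N : ∀ v : (thetaIndex (pilotDataOfK D K)).V, v ∈ (thetaIndex (pilotDataOfK D K)).Vbad → Type} [∀ v h, Monoid (N v h)]
  (qData : QPilotData ObΔ N)
  (tq : ∀ (pp : Nat.Primes) (x : (thetaIndex (pilotDataOfK D K)).Fibre (.inr pp)),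
    haveI : Fact (pp : ℕ).Prime := ⟨pp.2⟩; kOf (pilotDataOfK D K) pp.1 x)
  (t : ∀ (pp : Nat.Primes) (_ : Fin (pilotDataOfK D K).lstar) (x : (thetaIndex (pilotDataOfK D K)).Fibre (.inr pp)),
    haveI : Fact (pp : ℕ).Prime := ⟨pp.2⟩; kOf (pilotDataOfK D K) pp.1 x)
  (htq0 : ∀ pp x, tq pp x ≠ 0)
  (htq1 : ∀ (pp : Nat.Primes) (x : (thetaIndex (pilotDataOfK D K)).Fibre (.inr pp)),
    haveI : Fact (pp : ℕ).Prime := ⟨pp.2⟩; placeOf (pilotDataOfK D K) pp.1 x ∉ (pilotDataOfK D K).S → ‖tq pp x‖ = 1)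
  (col : ℤ → Column (logShellsDH (pilotDataOfK D K) logv))
  {eK : Nat.Primes → ℕ} {BK : Nat.Primes → ℤ}
  (ϖ : ∀ (pp : Nat.Primes) (x : (thetaIndex (pilotDataOfK D K)).Fibre (.inr pp)), haveI : Fact (pp : ℕ).Prime := ⟨pp.2⟩; kOf (pilotDataOfK D K) pp.1 x)
  (mq : ∀ pp : Nat.Primes, (thetaIndex (pilotDataOfK D K)).Fibre (.inr pp) → ℤ)

/-- **Q1 MOOT-ON-DATUM-Σ(16) in kernel.** For a genuine datum in Σ₁₆ (`InSigma16 D eK BK`), with a norm uniformizer `‖ϖ_x‖ = p^{−1/e_p}` on every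
fibre, the two per-place certificates of row 15's dictionary at `(n₀, λ) = (1, −B_p/e_p)` (one non-log-unit of norm `≤ 1`; one log-unit of norm
`≥ p^{−B_p/e_p}`), and the honest idele profile of REALISING ideles at the bad places (`‖t_q‖ ≤ 1`; `‖t_Θ‖ = 1` off `S`; INTEGER Kummer orders
`m_q(w) = P_q(w)` — `Cor312Prov.exists_nat_qPilot_pilotDataOfK`; `‖t_{q,w}‖ = ‖ϖ_w‖^{m_q(w)}`, `‖t_{Θ,j,w}‖ = ‖ϖ_w‖^{j²·m_q(w)}`), branch C's antecedent
`∃ ρ qK, QPinned ∧ PilotKummerCompatHull` holds at `settingPrVolSharp (pilotDataOfK D K) …` at EVERY packet `(j, v_ℚ)` — the `hSHw` body of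
`Conditional.abc_of_SH_v10K_window` (p447945): inside a datum of Σ₁₆ there is no off-Σ cell. abc-iut-rh-typ-5's end-to-end door
`DiffPricedDoor.exists_qPinned_and_hull_settingPrVolSharp_pilotDataOfK_of_hStarDiffPriced` (p464040 ∘ abc-iut-rp-d3's p462301), BY NAME, with `B_p ≤ 1`
from the untied certificate. [cite: DupuyHilado2025, §3.3, §3.9, §4.9] [cite: WeilBNT1967, Ch. II §2, Th. 1] [cite: SerreLocalFields1979, Ch. III §6 Prop. 13]
[claim: Mochizuki2012, status: disputed] -/
theorem exists_qPinned_and_hull_pilotDataOfK_of_inSigma16 (htqle : ∀ pp x, ‖tq pp x‖ ≤ 1)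
    (hϖ : ∀ (pp : Nat.Primes) (x : (thetaIndex (pilotDataOfK D K)).Fibre (.inr pp)), haveI : Fact (pp : ℕ).Prime := ⟨pp.2⟩
      ‖ϖ pp x‖ = (pp : ℝ) ^ (-(1 : ℝ) / ((eK pp : ℕ) : ℝ)))
    (hsharp : ∀ (pp : Nat.Primes) (x : (thetaIndex (pilotDataOfK D K)).Fibre (.inr pp)), haveI : Fact (pp : ℕ).Prime := ⟨pp.2⟩
      ∃ u : kOf (pilotDataOfK D K) pp.1 x, ‖u‖ ≤ ‖ϖ pp x‖ ^ (((1 : ℕ) : ℤ) - 1) ∧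
        u ∉ (logUnits (kOf (pilotDataOfK D K) pp.1 x) : Set (kOf (pilotDataOfK D K) pp.1 x)))
    (hrad : ∀ (pp : Nat.Primes) (x : (thetaIndex (pilotDataOfK D K)).Fibre (.inr pp)), haveI : Fact (pp : ℕ).Prime := ⟨pp.2⟩
      ∃ z ∈ (logUnits (kOf (pilotDataOfK D K) pp.1 x) : Set (kOf (pilotDataOfK D K) pp.1 x)),
        (pp : ℝ) ^ (-((BK pp : ℤ) : ℝ) / ((eK pp : ℕ) : ℝ)) ≤ ‖z‖)
    (ht1 : ∀ (pp : Nat.Primes) (i : Fin (pilotDataOfK D K).lstar) (x : (thetaIndex (pilotDataOfK D K)).Fibre (.inr pp)),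
      haveI : Fact (pp : ℕ).Prime := ⟨pp.2⟩; placeOf (pilotDataOfK D K) pp.1 x ∉ (pilotDataOfK D K).S → ‖t pp i x‖ = 1)
    (hΘ : ∀ (pp : Nat.Primes) (i : Fin (pilotDataOfK D K).lstar) (w : (thetaIndex (pilotDataOfK D K)).Fibre (.inr pp)),
      haveI : Fact (pp : ℕ).Prime := ⟨pp.2⟩
      placeOf (pilotDataOfK D K) pp.1 w ∈ (pilotDataOfK D K).S → ‖t pp i w‖ = ‖ϖ pp w‖ ^ ((((((i : ℕ) : ℤ) + 1) ^ 2) * mq pp w)))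
    (hq : ∀ (pp : Nat.Primes) (w : (thetaIndex (pilotDataOfK D K)).Fibre (.inr pp)), haveI : Fact (pp : ℕ).Prime := ⟨pp.2⟩
      placeOf (pilotDataOfK D K) pp.1 w ∈ (pilotDataOfK D K).S → ‖tq pp w‖ = ‖ϖ pp w‖ ^ (mq pp w))
    (hmq : ∀ (pp : Nat.Primes) (w : (thetaIndex (pilotDataOfK D K)).Fibre (.inr pp)), haveI : Fact (pp : ℕ).Prime := ⟨pp.2⟩
      placeOf (pilotDataOfK D K) pp.1 w ∈ (pilotDataOfK D K).S →
        (mq pp w : ℝ) = (pilotDataOfK D K).qPilot (placeOf (pilotDataOfK D K) pp.1 w))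
    (h : InSigma16 D eK BK) :
    ∃ (ρ' : (∀ v : (thetaIndex (pilotDataOfK D K)).V, v ∈ (thetaIndex (pilotDataOfK D K)).Vbad →
            Set ((logShellsDH (pilotDataOfK D K) logv).StarPacket v)) →
          ∀ (j : (thetaIndex (pilotDataOfK D K)).Label) (vQ : (thetaIndex (pilotDataOfK D K)).VQ),
            Set ((logShellsDH (pilotDataOfK D K) logv).Packet j vQ))
        (qK : ∀ v : (thetaIndex (pilotDataOfK D K)).V, v ∈ (thetaIndex (pilotDataOfK D K)).Vbad →
          Set ((logShellsDH (pilotDataOfK D K) logv).StarPacket v)),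
        QPinned ({ toSituation := situationPrVol (pilotDataOfK D K) hlog M archPk archSub Ψ act Mmod region, col := col } :
            LatticeSituation (thetaIndex (pilotDataOfK D K)))
          (settingPrVolSharp (pilotDataOfK D K) hlog M archPk archSub Ψ act Mmod region n lat sig split qData tq t htq0 htq1) ρ' qK ∧
        PilotKummerCompatHull ({ toSituation := situationPrVol (pilotDataOfK D K) hlog M archPk archSub Ψ act Mmod region, col := col } :
            LatticeSituation (thetaIndex (pilotDataOfK D K)))
          (settingPrVolSharp (pilotDataOfK D K) hlog M archPk archSub Ψ act Mmod region n lat sig split qData tq t htq0 htq1) ρ' qK :=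
  DiffPricedDoor.exists_qPinned_and_hull_settingPrVolSharp_pilotDataOfK_of_hStarDiffPriced D hlog M archPk archSub Ψ act Mmod region n lat
    sig split qData tq t htq0 htq1 col eK BK ϖ mq htqle h.2.1 (fun pp w hw => (h.2.2 pp w ⟨w, hw⟩).1)
    (fun pp w hw => (h.2.2 pp w ⟨w, hw⟩).2.1) (outer_le_one_of_inSigma16 D h) hϖ hsharp hrad ht1 hΘ hq hmq h.1

end Row16

/-! ## §2. Row 27 «reach-ledger»: `InSigma27 (D)` — the `D`-level form of `LedgerAtDatum`; doorless (the door is the TARGET `K2Target27`) -/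

section Row27

variable {F K Fbar : Type} [Field F] [NumberField F] [Field K] [NumberField K] [Algebra F K] [Field Fbar]
  [Algebra F Fbar] [Algebra K Fbar] {E : WeierstrassCurve F} [E.IsElliptic] {l : ℕ} {Pb : BadPlacePredicates K}
  (D : InitialThetaData F K Fbar E l Pb)

/-- **`InSigma27 D` — the datum `D` lies in the stratum Σ₂₇ of ROUND-1 row 27 «reach-ledger»** (signed KEEP-on-stratum «frey: Szpiro-bad ∧ window»,
DOORLESS — budget class, Statement-sufficient via the new lemma L1, NOT S_H-sufficient): abc-iut-lens-nearmiss-1's per-place label-averaged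
mover-reach LEDGER `ReachLedger.LedgerCell l⋆ p e_w P_w` («`0 ≤ Σ_{j=1}^{l⋆} ⌊((j+1)·D(p,e_w) − (j²−1)·P_w − e_w)/e_w⌋`») at EVERY bad place `w ∣ p` of
the genuine `K`-level datum `pilotDataOfK D K`, with the dictionary of record `e_w := e(w ∣ p)` and `m_q(w) := P_w ∈ ℕ` the q-pilot degree
(`Cor312Prov.exists_nat_qPilot_pilotDataOfK`). This is abc-iut-rh-typ-10's `ReachLedgerQ2.LedgerAtDatum T` read at `D := T.D`
(`ledgerAtDatum_iff_inSigma27`). The predicate quantifies over ALL bad places and sums over ALL labels: inside a datum of Σ₂₇ no cell is off Σ.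
One-line specialisation; NOT asserted at any datum. [R-H datum class, hypothesis — not a fact]
[cite: Mochizuki2012, IUTchIII Prop. 3.9 (i) p. 116; Rmk. 3.9.3 pp. 119–120] [claim: Mochizuki2012, status: disputed] -/
@[claim "Mochizuki2012" "disputed"]
def InSigma27 : Prop :=
  ∀ (pp : Nat.Primes) (w : (thetaIndex (pilotDataOfK D K)).Fibre (.inr pp)),
    haveI : Fact (pp : ℕ).Prime := ⟨pp.2⟩
    placeOf (pilotDataOfK D K) pp.1 w ∈ (pilotDataOfK D K).S →
      ∀ Pw : ℕ, (pilotDataOfK D K).qPilot (placeOf (pilotDataOfK D K) pp.1 w) = Pw →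
        ReachLedger.LedgerCell (thetaIndex (pilotDataOfK D K)).lstar (pp : ℕ)
          ((placeOf (pilotDataOfK D K) pp.1 w).asIdeal.ramificationIdx ℤ) (Pw : ℤ)

/-- `InSigma27 D` unfolds to the per-place ledger cells at the bad places with the dictionary of record. [folklore] -/
theorem inSigma27_iff :
    InSigma27 D ↔
      ∀ (pp : Nat.Primes) (w : (thetaIndex (pilotDataOfK D K)).Fibre (.inr pp)),
        haveI : Fact (pp : ℕ).Prime := ⟨pp.2⟩
        placeOf (pilotDataOfK D K) pp.1 w ∈ (pilotDataOfK D K).S →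
          ∀ Pw : ℕ, (pilotDataOfK D K).qPilot (placeOf (pilotDataOfK D K) pp.1 w) = Pw →
            ReachLedger.LedgerCell (thetaIndex (pilotDataOfK D K)).lstar (pp : ℕ)
              ((placeOf (pilotDataOfK D K) pp.1 w).asIdeal.ramificationIdx ℤ) (Pw : ℤ) :=
  Iff.rfl

/-- `InSigma27 D` IS abc-iut-lens-nearmiss-1's `HStarReachLedgerK D e mq` (p464022) at the dictionary `e = e(w ∣ p)`, `mq = P_w` (given the q-pilot
degrees as naturals `Pw`) — the proof of abc-iut-rh-typ-10's `ledgerAtDatum_iff_hStarReachLedgerK`, verbatim at `D`. [folklore] -/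
theorem inSigma27_iff_hStarReachLedgerK
    (Pw : ∀ pp : Nat.Primes, (thetaIndex (pilotDataOfK D K)).Fibre (.inr pp) → ℕ)
    (hPw : ∀ (pp : Nat.Primes) (w : (thetaIndex (pilotDataOfK D K)).Fibre (.inr pp)), haveI : Fact (pp : ℕ).Prime := ⟨pp.2⟩;
      (pilotDataOfK D K).qPilot (placeOf (pilotDataOfK D K) pp.1 w) = Pw pp w) :
    InSigma27 D ↔
      ReachLedger.HStarReachLedgerK D
        (fun pp w => haveI : Fact (pp : ℕ).Prime := ⟨pp.2⟩; (placeOf (pilotDataOfK D K) pp.1 w).asIdeal.ramificationIdx ℤ)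
        (fun pp w => (Pw pp w : ℤ)) := by
  constructor
  · intro h pp w hw
    exact h pp w hw (Pw pp w) (hPw pp w)
  · intro h pp w hw P' hP'
    have hP : Pw pp w = P' := by exact_mod_cast (hPw pp w).symm.trans hP'
    subst hP
    exact h pp w hw

end Row27

section Row27Datum

open Literature.NumberTheory.DiophantineGeometry.GenEll Summit.ABC.ABC.Theorems

/-- **`LedgerAtDatum T ↔ InSigma27 T.D`**: abc-iut-rh-typ-10's row-27 ledger at a genuine Θ-volume datum `T` (p468994) is `InSigma27` of its
initial Θ-data, definitionally. [folklore] -/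
theorem ledgerAtDatum_iff_inSigma27 {P : NFPoint} {l : ℕ} (T : Cor22.ThetaVolumeDatumAt P l) :
    letI := T.instFieldF; letI := T.instNumberFieldF; letI := T.instAlgebraF; letI := T.instFieldK;
    letI := T.instNumberFieldK; letI := T.instAlgebraK; letI := T.instFieldFbar; letI := T.instAlgebraFbar;
    letI := T.instAlgebraKFbar; letI := T.instIsElliptic;
    ReachLedgerQ2.LedgerAtDatum T ↔ InSigma27 T.D :=
  Iff.rfl

/-- **«S RESTRICTED TO Σ₂₇» in the `InSig` grammar**: abc-iut-rh-typ-10's `HStar27OnSigma27` (p468994) says exactly «every admissible SZPIRO-BAD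
`(P, l)` and every datum `T` OFF the depth locus (the window antecedents of p450130's `hSHwBad`, verbatim) has `InSigma27 T.D`» — i.e. the stratum
binder `hSigmaBad` of abc-iut-rh2-q2-hull's generic cut `RH2SigmaHull.abc_of_inSigma_v10K_window_szpiroBadBoth` at `InSig P l T := InSigma27 T.D`.
Definitional. Row 27 has NO door «`InSig T` ⟹ hSHw body» (not S_H-sufficient by design); its first arrow is the TARGET `ReachLedgerQ2.K2Target27`.
[claim: Mochizuki2012, status: disputed] -/
theorem hStar27OnSigma27_iff_forall_inSigma27 :
    ReachLedgerQ2.HStar27OnSigma27 ↔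
      ∀ (P : NFPoint), P ∈ UP → ∀ (l : ℕ), l.Prime → 5 ≤ l →
        Cor22.AdmitsCore P → Cor22.CondP2 P l → Cor22.CondP5 P l → Cor22.CondP6 P l →
        (((l : ℝ) + 5) / 4 < (Cor22.dmod P : ℝ) ∨
          6 * l * (((l : ℝ) + 5) - 4 * Cor22.dmod P) / (((l : ℝ) + 4) * ((l : ℝ) - 3))
              * (P.logDiff + (1 - 1 / (l : ℝ)) * Cor22.logCondAvoid P {2, l})
            + 6 * l * ((l : ℝ) + 5) / (((l : ℝ) + 4) * ((l : ℝ) - 3)) * Real.log Real.pi < Cor22.logQAvoid P {2, l}) →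
        ∀ (T : Cor22.ThetaVolumeDatumAt P l), letI := T.instFieldF; letI := T.instNumberFieldF; letI := T.instAlgebraF; letI := T.instFieldK;
          letI := T.instNumberFieldK; letI := T.instAlgebraK; letI := T.instFieldFbar; letI := T.instAlgebraFbar;
          letI := T.instAlgebraKFbar; letI := T.instIsElliptic;
        ¬ (∃ (pp : Nat.Primes) (_ : 2 < (pp : ℕ)) (i : Fin (thetaIndex (pilotDataOfK T.D T.K)).lstar)
            (x₀ : (thetaIndex (pilotDataOfK T.D T.K)).Fibre (.inr pp)),
          haveI : Fact (pp : ℕ).Prime := ⟨pp.2⟩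
          ((pp : ℕ) : ℝ) ^ ((((i : ℕ) : ℝ) + 2) * (4 + 2 * Real.logb (pp : ℕ) (Module.finrank ℚ T.K)) + 1) *
            ‖(exists_realising_qIdeles_pilotDataOfK T.D).choose pp x₀‖ ^ (((i : ℕ) + 1) ^ 2 - 1) < 1) →
        InSigma27 T.D :=
  Iff.rfl

/-- **Row 27's two arrows in the `InSigma27` grammar** (re-reading abc-iut-rh-typ-10's `cor312OnSigma27_of_k2Target27`): the TARGET `K2Target27`
(«S|Σ₂₇ ⇒ Cor 3.12|Σ₂₇» per datum, NOT proved — (α)/(β) of abc-iut-rh2-L1) together with «every Σ₂₇-window datum is `InSigma27`» gives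
`Cor312OnSigma27`; `ABC` then follows by rh-typ-10's PROVED second arrow `abc_of_cor312OnSigma27` with its NUM and CONE binders. Pure logic; nothing
asserted. [claim: Mochizuki2012, status: disputed] -/
theorem cor312OnSigma27_of_k2Target27_of_forall_inSigma27 (hK2 : ReachLedgerQ2.K2Target27)
    (hS : ∀ (P : NFPoint), P ∈ UP → ∀ (l : ℕ), l.Prime → 5 ≤ l →
        Cor22.AdmitsCore P → Cor22.CondP2 P l → Cor22.CondP5 P l → Cor22.CondP6 P l →
        (((l : ℝ) + 5) / 4 < (Cor22.dmod P : ℝ) ∨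
          6 * l * (((l : ℝ) + 5) - 4 * Cor22.dmod P) / (((l : ℝ) + 4) * ((l : ℝ) - 3))
              * (P.logDiff + (1 - 1 / (l : ℝ)) * Cor22.logCondAvoid P {2, l})
            + 6 * l * ((l : ℝ) + 5) / (((l : ℝ) + 4) * ((l : ℝ) - 3)) * Real.log Real.pi < Cor22.logQAvoid P {2, l}) →
        ∀ (T : Cor22.ThetaVolumeDatumAt P l), letI := T.instFieldF; letI := T.instNumberFieldF; letI := T.instAlgebraF; letI := T.instFieldK;
          letI := T.instNumberFieldK; letI := T.instAlgebraK; letI := T.instFieldFbar; letI := T.instAlgebraFbar;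
          letI := T.instAlgebraKFbar; letI := T.instIsElliptic;
        ¬ (∃ (pp : Nat.Primes) (_ : 2 < (pp : ℕ)) (i : Fin (thetaIndex (pilotDataOfK T.D T.K)).lstar)
            (x₀ : (thetaIndex (pilotDataOfK T.D T.K)).Fibre (.inr pp)),
          haveI : Fact (pp : ℕ).Prime := ⟨pp.2⟩
          ((pp : ℕ) : ℝ) ^ ((((i : ℕ) : ℝ) + 2) * (4 + 2 * Real.logb (pp : ℕ) (Module.finrank ℚ T.K)) + 1) *
            ‖(exists_realising_qIdeles_pilotDataOfK T.D).choose pp x₀‖ ^ (((i : ℕ) + 1) ^ 2 - 1) < 1) →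
        InSigma27 T.D) :
    ReachLedgerQ2.Cor312OnSigma27 :=
  ReachLedgerQ2.cor312OnSigma27_of_k2Target27 hK2 (hStar27OnSigma27_iff_forall_inSigma27.2 hS)

end Row27Datum

end Summit.ABC.IUTFork.Repair.RH.InSigmaDatum

end

/-! ## §3. (APPENDED, gen 2) Row 16: `InSigma16` ⟹ the side-condition binder `hside` of abc-iut-rh2-q2-hull's `RH2SigmaHullRow16` (p472572) -/

namespace Summit.ABC.IUTFork.Repair.RH.InSigmaDatum
open NumberField IsDedekindDomain Literature.IUT.LogVolume Literature.IUT.HodgeTheaters Literature.IUT.LogVolume.ThetaData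
  Summit.ABC.IUTFork.Thm311 Summit.ABC.IUTFork.Thm311.Real Summit.ABC.IUTFork.Cor312 Summit.ABC.IUTFork.Cor312Prov
variable {F K Fbar : Type} [Field F] [NumberField F] [Field K] [NumberField K] [Algebra F K] [Field Fbar] [Algebra F Fbar]
  [Algebra K Fbar] {E : WeierstrassCurve F} [E.IsElliptic] {l : ℕ} {Pb : BadPlacePredicates K} (D : InitialThetaData F K Fbar E l Pb)

/-- **`InSigma16` with ODD bad primes ⟹ the `hside` binder of abc-iut-rh2-q2-hull's chosen-ideles door** (`RH2SigmaHull.exists_certifiedWindow_of_hStarDiffPriced`,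
`pilotKummerCompatHull_chosen_of_hStarDiffPriced`, `abc_of_sigma16_v10K_window_szpiroBadBoth`, p472572) in its `ramIdx` currency (`ramIdx_eq : ramIdx K x = e(x ∣ p)`): hence
«`InSigma16 T.D eK BK` ∧ bad primes odd» ALONE gives the hSHw body at the certificates' bed through that door — row 16's MOOT door with no residual hypothesis. [folklore] -/
theorem hside_of_inSigma16 {eK : Nat.Primes → ℕ} {BK : Nat.Primes → ℤ} (h : InSigma16 D eK BK)
    (hodd : ∀ (pp : Nat.Primes) (w : (thetaIndex (pilotDataOfK D K)).Fibre (.inr pp)), haveI : Fact (pp : ℕ).Prime := ⟨pp.2⟩;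
      placeOf (pilotDataOfK D K) pp.1 w ∈ (pilotDataOfK D K).S → 2 < (pp : ℕ)) :
    ∀ (pp : Nat.Primes) (w : (thetaIndex (pilotDataOfK D K)).Fibre (.inr pp)), haveI : Fact (pp : ℕ).Prime := ⟨pp.2⟩;
      placeOf (pilotDataOfK D K) pp.1 w ∈ (pilotDataOfK D K).S →
        2 < (pp : ℕ) ∧ (∀ x : (thetaIndex (pilotDataOfK D K)).Fibre (.inr pp),
          ramIdx K (placeOf (pilotDataOfK D K) pp.1 x) = ramIdx K (placeOf (pilotDataOfK D K) pp.1 w)) ∧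
        ¬ (pp : ℕ) ∣ ramIdx K (placeOf (pilotDataOfK D K) pp.1 w) ∧
        ∃ r : ℤ, RHHeightClass.StrictMinPow (pp : ℕ) (ramIdx K (placeOf (pilotDataOfK D K) pp.1 w)) r := by
  intro pp w hw
  haveI : Fact (pp : ℕ).Prime := ⟨pp.2⟩
  have hfib := fun x : (thetaIndex (pilotDataOfK D K)).Fibre (.inr pp) => h.2.2 pp x ⟨w, hw⟩
  have hew : ramIdx K (placeOf (pilotDataOfK D K) pp.1 w) = eK pp := (ramIdx_eq K _).trans (hfib w).1
  refine ⟨hodd pp w hw, fun x => ((ramIdx_eq K _).trans (hfib x).1).trans hew.symm, ?_, ⟨BK pp, ?_⟩⟩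
  · rw [hew]; exact (hfib w).2.1
  · rw [hew]; exact (hfib w).2.2

end Summit.ABC.IUTFork.Repair.RH.InSigmaDatum
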